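import Mathlib
import Literature.Analysis.FluidPDE.EulerReynoldsLadderGluingLimit
import Literature.Analysis.FluidPDE.EulerReynoldsLadderGluingDiv
import Literature.Analysis.FluidPDE.MollifiedEulerConePressure
import HarnessLib

/-!
# Ladder gluing of steady Euler–Reynolds subsolutions, V: the free-space sink completion from a
# ladder datum (the residual interface)

Analysis/FluidPDE support file (everything proved; no definitions, no named facts). Fifth of the
`EulerReynoldsLadderGluing*` files (tool T8 of the free-space sink completion, route PointSink
of the anomalous-dissipation summit, stub `stub_freeSpaceSinkCompletion`, crux
stmt-AnomalousDissipation-19035). It pins, as ONE proved implication, what the mollifier-ladder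
CONSTRUCTION still has to deliver (a "ladder datum") in order that the ten clauses of the
free-space sink completion hold for a measurable cone `V` with `|V|² ∈ L¹_loc(ℝ³)`:

* `sinkCompletion_of_ladder` — given radii `0 < r₀ < r₁`, a level `c > 0`, a glued velocity
  `U` (`= V` on `|x| < r₀`, `= 0` on `|x| ≥ r₁`, smooth and divergence free on `{r₀ < |x|}`,
  `U ∈ L²`), a recorded stress `R` (`= 0` on `|x| ≤ r₀`, `= c·Id` on `|x| ≥ r₁`, smooth and
  positive definite on `{r₀ < |x|}`, integrable on `B_{r₁}`, entries locally integrable), a full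
  glued stress `M` (`C¹`, row-divergence free, `M = U⊗U + R + p·Id` on `{r₀ < |x|}`) and layers
  `(u_N, S_N, P_N)` on `{d_N < |x|}` (divergence free / `div(S_N + P_N Id) = 0`, `d_N → 0`)
  which COINCIDE with `(U, M)` on shells `s_N < |x| < s'_N`, `r₀ < s_N`, `s'_N → r₀`, and converge
  to `(V, V⊗V)` in `L¹` on shells off the origin — THEN the ten clauses hold: the eight
  structural ones verbatim, the weak divergence-free constraint on all of `ℝ³` by part III
  (`integral_inner_gradient_eq_zero_of_ladder_of_sq`: matching across the sphere + removable
  sink) and the weak Euler–Reynolds identity off the origin by part II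
  (`integral_eulerReynolds_eq_zero_of_ladder`).
* `ladderLayer_of_mollifier` — the LAYERS of such a datum are supplied by the tree: for `V` a
  pressure-free weak Euler field off the origin, weakly divergence free off the origin, with
  `|V|² ∈ L¹_loc(ℝ³)`, and a smooth kernel `ρ` supported in `B_δ`, the mollified triple
  `u = ρ ⋆ V`, `Sᵢⱼ = ρ ⋆ (VᵢVⱼ)`, `P` = the mollified pressure of
  `MollifiedEulerCone.exists_mollified_pressure`, satisfies the five layer hypotheses of
  `sinkCompletion_of_ladder` on `{4δ < |x|}` (format conversion `∇P = -div S` ↦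
  `Σⱼ ∂ⱼSᵢⱼ + ∂ᵢP = 0`).

What is NOT here (the residual analytic content of the stub, recorded in its work file): the
construction of the datum — mollified layers (tree: `MollifiedEulerConePressure`), blend shells
with compactly supported correctors (part IV gives the pointwise algebra; the correctors need a
Bogovskiĭ / symmetric anti-divergence operator with smooth compactly supported output on thin
shells and negative-order `W^{-1,r}` bounds, absent from the tree), the outer cut-off to rest,
and the `L¹`/`L²` summability bookkeeping.

## References

* C. De Lellis, L. Székelyhidi Jr., Arch. Ration. Mech. Anal. 195 (2010) 225–260, §2.
  [DeLellisSzekelyhidi2010]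
* G. P. Galdi, *An Introduction to the Mathematical Theory of the Navier–Stokes Equations*
  (2011), §III.3–III.4. [Galdi2011]
-/

noncomputable section

open MeasureTheory Filter Topology Set Metric Function
open scoped RealInnerProductSpace ContDiff Convolution

namespace Literature.Analysis.FluidPDE

namespace EulerReynoldsLadder

/-- **The free-space sink completion from a ladder datum.** See the module docstring. The
conclusion is literally the ten-clause conclusion of the summit's stub
`stub_freeSpaceSinkCompletion` (route PointSink, crux stmt-AnomalousDissipation-19035), for a
measurable `V` with `|V|² ∈ L¹_loc(ℝ³)`. [folklore] -/
theorem sinkCompletion_of_ladder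
    {V : EuclideanSpace ℝ (Fin 3) → EuclideanSpace ℝ (Fin 3)} (hVm : AEStronglyMeasurable V volume)
    (hV2 : LocallyIntegrable (fun x => ‖V x‖ ^ 2) volume)
    {r₀ r₁ c : ℝ} {U : EuclideanSpace ℝ (Fin 3) → EuclideanSpace ℝ (Fin 3)}
    {R M : EuclideanSpace ℝ (Fin 3) → Fin 3 → Fin 3 → ℝ} {p : EuclideanSpace ℝ (Fin 3) → ℝ}
    {S : ℕ → EuclideanSpace ℝ (Fin 3) → Fin 3 → Fin 3 → ℝ} {P : ℕ → EuclideanSpace ℝ (Fin 3) → ℝ}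
    {u : ℕ → EuclideanSpace ℝ (Fin 3) → EuclideanSpace ℝ (Fin 3)} {d s s' : ℕ → ℝ}
    -- the eight structural clauses
    (hr : 0 < r₀ ∧ r₀ < r₁ ∧ 0 < c)
    (hUV : ∀ x, ‖x‖ < r₀ → U x = V x)
    (hR0 : ∀ x : EuclideanSpace ℝ (Fin 3), ‖x‖ ≤ r₀ → R x = 0)
    (hrest : ∀ x : EuclideanSpace ℝ (Fin 3), r₁ ≤ ‖x‖ →
      U x = 0 ∧ R x = fun i j => if i = j then c else 0)
    (hUs : ContDiffOn ℝ ∞ U {x | r₀ < ‖x‖}) (hRs : ContDiffOn ℝ ∞ R {x | r₀ < ‖x‖})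
    (hpos : ∀ x : EuclideanSpace ℝ (Fin 3), r₀ < ‖x‖ → (Matrix.of (R x)).PosDef)
    (hU2 : MemLp U 2 volume)
    (hRi : IntegrableOn R (ball (0 : EuclideanSpace ℝ (Fin 3)) r₁) volume)
    (hRloc : ∀ i j, LocallyIntegrable (fun x => R x i j) volume)
    -- the glued pair on the exterior
    (hUdiv : ∀ x : EuclideanSpace ℝ (Fin 3), r₀ < ‖x‖ → VectorCalculus.divergence U x = 0)
    (hM : ∀ i j, ContDiffOn ℝ 1 (fun x => M x i j) {x | r₀ < ‖x‖})
    (hMdiv : ∀ x : EuclideanSpace ℝ (Fin 3), r₀ < ‖x‖ → ∀ i,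
      ∑ j, fderiv ℝ (fun y => M y i j) x (EuclideanSpace.single j 1) = 0)
    (hMR : ∀ x : EuclideanSpace ℝ (Fin 3), r₀ < ‖x‖ → ∀ i j,
      M x i j = U x i * U x j + R x i j + if i = j then p x else 0)
    -- the layers
    (hS : ∀ N i j, ContDiffOn ℝ 1 (fun x => S N x i j) {x | d N < ‖x‖})
    (hP : ∀ N, ContDiffOn ℝ 1 (P N) {x | d N < ‖x‖})
    (hSP : ∀ (N : ℕ) (x : EuclideanSpace ℝ (Fin 3)), d N < ‖x‖ → ∀ i,
      ∑ j, fderiv ℝ (fun y => S N y i j) x (EuclideanSpace.single j 1) +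
        fderiv ℝ (P N) x (EuclideanSpace.single i 1) = 0)
    (hu : ∀ N, ContDiffOn ℝ 1 (u N) {x | d N < ‖x‖})
    (hudiv : ∀ (N : ℕ) (x : EuclideanSpace ℝ (Fin 3)), d N < ‖x‖ →
      VectorCalculus.divergence (u N) x = 0)
    (hrs : ∀ N, r₀ < s N) (hss' : ∀ N, s N < s' N)
    (hd : Tendsto d atTop (𝓝 0)) (hs' : Tendsto s' atTop (𝓝 r₀))
    (hagreeU : ∀ (N : ℕ) (x : EuclideanSpace ℝ (Fin 3)), s N < ‖x‖ → ‖x‖ < s' N → U x = u N x)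
    (hagreeM : ∀ (N : ℕ) (x : EuclideanSpace ℝ (Fin 3)), s N < ‖x‖ → ‖x‖ < s' N → ∀ i j,
      M x i j = S N x i j + if i = j then P N x else 0)
    (hconvS : ∀ a b : ℝ, 0 < a → a < b → Tendsto (fun N =>
      ∫ x in {x : EuclideanSpace ℝ (Fin 3) | a < ‖x‖ ∧ ‖x‖ < b},
        ∑ i, ∑ j, |S N x i j - V x i * V x j|) atTop (𝓝 0))
    (hconvU : ∀ a b : ℝ, 0 < a → a < b → Tendsto (fun N =>
      ∫ x in {x : EuclideanSpace ℝ (Fin 3) | a < ‖x‖ ∧ ‖x‖ < b}, ‖u N x - V x‖) atTop (𝓝 0)) :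
    ∃ (r₀ r₁ c : ℝ) (U : EuclideanSpace ℝ (Fin 3) → EuclideanSpace ℝ (Fin 3))
      (R : EuclideanSpace ℝ (Fin 3) → Fin 3 → Fin 3 → ℝ),
      (0 < r₀ ∧ r₀ < r₁ ∧ 0 < c) ∧
      (∀ x : EuclideanSpace ℝ (Fin 3), 0 < ‖x‖ → ‖x‖ < r₀ → U x = V x) ∧
      (∀ x : EuclideanSpace ℝ (Fin 3), ‖x‖ ≤ r₀ → R x = 0) ∧
      (∀ x : EuclideanSpace ℝ (Fin 3), r₁ ≤ ‖x‖ →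
        U x = 0 ∧ R x = fun i j => if i = j then c else 0) ∧
      ContDiffOn ℝ ∞ U {x : EuclideanSpace ℝ (Fin 3) | r₀ < ‖x‖} ∧
      ContDiffOn ℝ ∞ R {x : EuclideanSpace ℝ (Fin 3) | r₀ < ‖x‖} ∧
      (∀ x : EuclideanSpace ℝ (Fin 3), r₀ < ‖x‖ → (Matrix.of (R x)).PosDef) ∧
      (MemLp U 2 volume ∧ IntegrableOn R (ball (0 : EuclideanSpace ℝ (Fin 3)) r₁) volume) ∧
      (∀ θ : EuclideanSpace ℝ (Fin 3) → ℝ, ContDiff ℝ ∞ θ → HasCompactSupport θ →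
        ∫ x, ⟪U x, gradient θ x⟫ = 0) ∧
      (∀ w : EuclideanSpace ℝ (Fin 3) → EuclideanSpace ℝ (Fin 3),
        FunctionSpaces.IsTestFunctionOn ⟨{x : EuclideanSpace ℝ (Fin 3) | x ≠ 0}, isOpen_ne⟩ w →
        (∀ x, VectorCalculus.divergence w x = 0) →
        ∫ x, (⟪U x, fderiv ℝ w x (U x)⟫ +
          ∑ i, ∑ j, R x i j * fderiv ℝ w x (EuclideanSpace.single j 1) i) = 0) := by
  -- local integrability of the glued velocity and of the cone
  have hUm : AEStronglyMeasurable U volume := hU2.1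
  have hU2' : LocallyIntegrable (fun x => ‖U x‖ ^ 2) volume :=
    ((memLp_two_iff_integrable_sq_norm hUm).1 hU2).locallyIntegrable
  have hV : LocallyIntegrableOn V {x : EuclideanSpace ℝ (Fin 3) | x ≠ 0} volume :=
    (locallyIntegrable_of_normSq hVm hV2).locallyIntegrableOn _
  have hUs1 : ContDiffOn ℝ 1 U {x | r₀ < ‖x‖} := hUs.of_le (by exact_mod_cast le_top)
  refine ⟨r₀, r₁, c, U, R, hr, fun x _ hx => hUV x hx, hR0, hrest, hUs, hRs, hpos, ⟨hU2, hRi⟩,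
    fun θ hθ hθc => ?_, fun w hw hwdiv => ?_⟩
  · -- clause 9: matching across the sphere (part III) + the removable sink
    exact integral_inner_gradient_eq_zero_of_ladder_of_sq hr.1 hUm hU2' hV hUV hUs1 hUdiv hu
      hudiv hrs hss' hd hs' hagreeU hconvU hθ hθc
  · -- clause 10: matching across the sphere (part II)
    exact integral_eulerReynolds_eq_zero_of_ladder hr.1 hVm hV2 hUm hU2' hRloc hUV
      (fun x hx => hR0 x hx.le) hM hMdiv hMR hS hP hSP hrs hss' hd hs' hagreeM hconvS hw hwdiv

/-- **The layers of a ladder datum from the mollified cone.** Let `V : ℝ³ → ℝ³` be measurable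
with `|V|² ∈ L¹_loc(ℝ³)`, a pressure-free weak steady Euler field off the origin and weakly
divergence free off the origin, and let `ρ ∈ C^∞` with `support ρ ⊆ B_δ`. Then with
`u = ρ ⋆ V`, `Sᵢⱼ = ρ ⋆ (VᵢVⱼ)` there is a pressure `P` such that on `{4δ < |x|}`: the entries
of `S` and `P` are `C¹`, `Σⱼ ∂ⱼSᵢⱼ + ∂ᵢP = 0`, `u` is `C¹` and `div u = 0` — the five layer
hypotheses of `sinkCompletion_of_ladder` with `d = 4δ` (tree: `contDiff_convolution_flux`,
`exists_mollified_pressure`, `contDiff_convolution_velocity`,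
`divergence_convolution_velocity_eq_zero`). [folklore] -/
theorem ladderLayer_of_mollifier
    {V : EuclideanSpace ℝ (Fin 3) → EuclideanSpace ℝ (Fin 3)} (hVm : AEStronglyMeasurable V volume)
    (hV2 : LocallyIntegrable (fun x => ‖V x‖ ^ 2) volume)
    (hEuler : ∀ φ : EuclideanSpace ℝ (Fin 3) → EuclideanSpace ℝ (Fin 3),
      FunctionSpaces.IsTestFunctionOn ⟨{x : EuclideanSpace ℝ (Fin 3) | x ≠ 0}, isOpen_ne⟩ φ →
      (∀ x, VectorCalculus.divergence φ x = 0) → ∫ x, ⟪V x, fderiv ℝ φ x (V x)⟫ = 0)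
    (hwdiv : ∀ θ : EuclideanSpace ℝ (Fin 3) → ℝ,
      FunctionSpaces.IsTestFunctionOn ⟨{x : EuclideanSpace ℝ (Fin 3) | x ≠ 0}, isOpen_ne⟩ θ →
      ∫ x, ⟪V x, gradient θ x⟫ = 0)
    {ρ : EuclideanSpace ℝ (Fin 3) → ℝ} (hρ : ContDiff ℝ ∞ ρ) {δ : ℝ}
    (hρδ : support ρ ⊆ ball (0 : EuclideanSpace ℝ (Fin 3)) δ) :
    ∃ P : EuclideanSpace ℝ (Fin 3) → ℝ,
      (∀ i j, ContDiffOn ℝ 1 (fun x => (ρ ⋆[ContinuousLinearMap.lsmul ℝ ℝ, volume]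
        fun y => V y i * V y j) x) {x | 4 * δ < ‖x‖}) ∧
      ContDiffOn ℝ 1 P {x | 4 * δ < ‖x‖} ∧
      (∀ x : EuclideanSpace ℝ (Fin 3), 4 * δ < ‖x‖ → ∀ i,
        ∑ j, fderiv ℝ (fun y => (ρ ⋆[ContinuousLinearMap.lsmul ℝ ℝ, volume]
          fun y => V y i * V y j) y) x (EuclideanSpace.single j 1) +
          fderiv ℝ P x (EuclideanSpace.single i 1) = 0) ∧
      ContDiffOn ℝ 1 (ρ ⋆[ContinuousLinearMap.lsmul ℝ ℝ, volume] V) {x | 4 * δ < ‖x‖} ∧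
      (∀ x : EuclideanSpace ℝ (Fin 3), 4 * δ < ‖x‖ →
        VectorCalculus.divergence (ρ ⋆[ContinuousLinearMap.lsmul ℝ ℝ, volume] V) x = 0) := by
  have hρc : HasCompactSupport ρ := MollifiedEulerCone.hasCompactSupport_of_support_subset_ball hρδ
  obtain ⟨P, hPs, hPg⟩ := MollifiedEulerCone.exists_mollified_pressure hVm hV2 hEuler hρ hρδ
  have hSs : ∀ i j, ContDiff ℝ ∞ (ρ ⋆[ContinuousLinearMap.lsmul ℝ ℝ, volume]
      fun y => V y i * V y j) := fun i j =>
    MollifiedEulerCone.contDiff_convolution_flux hVm hV2 hρ hρc i j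
  refine ⟨P, fun i j => ((hSs i j).of_le (by exact_mod_cast le_top)).contDiffOn,
    hPs.of_le (by exact_mod_cast le_top), fun x hx i => ?_,
    ((MollifiedEulerCone.contDiff_convolution_velocity hVm hV2 hρ hρc).of_le
      (by exact_mod_cast le_top)).contDiffOn,
    fun x _ => MollifiedEulerCone.divergence_convolution_velocity_eq_zero hVm hV2 hwdiv hρ hρc x⟩
  -- `∂ᵢP = ⟪∇P, eᵢ⟫ = -Σⱼ ∂ⱼSᵢⱼ`
  have hfd := (hPg x hx).hasFDerivAt.fderiv
  rw [hfd, InnerProductSpace.toDual_apply_apply, inner_neg_left, sum_inner]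
  simp only [real_inner_smul_left, EuclideanSpace.inner_single_left, PiLp.single_apply,
    map_one, mul_ite, mul_one, mul_zero, Finset.sum_ite_eq', Finset.mem_univ, if_true]
  ring

end EulerReynoldsLadder

end Literature.Analysis.FluidPDE

end
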